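import Literature.Analysis.Matrix.KyFanMaximumPrinciple

/-!
# The Fermi-surface average of a linearised Eliashberg kernel cannot raise `T_c`

Companion to `EliashbergTcMonotonicity.lean` (the `μ*` corners of a `T_c` band). This file is the
kernel statement behind the LOWER edge `1.00` of the multiband/anisotropy box applied to an
ISOTROPIC Eliashberg `T_c` (e.g. MgB₂ in a conventional-superconductor screen): solving the
linearised gap equation with the Fermi-surface-AVERAGED kernel can only lower the largest eigenvalue,
hence only lower the threshold temperature, relative to the full anisotropic (multiband) kernel —
"anisotropy enhances `T_c`; washing it out (isotropic average, dirty limit) reduces `T_c` to the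
isotropic value" (Markowitz–Kadanoff 1963, in BCS language).

The mathematics is Poincaré separation (Horn–Johnson Cor. 4.3.37, in this library
`KyFan.eigenvalues₀_compression_le`): on `N` Matsubara frequencies and `M` Fermi-surface channels
with weights `w_k ≥ 0`, `Σ_k w_k = 1`, the anisotropic symmetrised kernel is a real symmetric matrix
`K` on `M × N`; the vectors `u_n = (√w_k · δ_{mn})_{(k,m)}` are orthonormal, and the isotropic
kernel — the double Fermi-surface average `B_{nn'} = Σ_{k,k'} √w_k √w_k' K_{(k,n),(k',n')}` — is
exactly the compression `[u_nᵀ K u_n']`. Hence `λ_j↓(B) ≤ λ_j↓(K)` for every `j`, in particular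
for the top eigenvalue `ρ` that decides `T < T_c`, and the super-level set `{T | 1 ≤ ρ}` of the
averaged problem is contained in that of the anisotropic one.

Proved here:
* `fsAverageFrame`, `fsAverageFrame_orthonormal` — the averaging frame and its orthonormality;
* `isotropicCompression`, `isotropicCompression_apply` — `B = [u_nᵀ K u_n']` and its double-sum form;
* `eigenvalues₀_isotropicCompression_le` — `λ_j↓(B) ≤ λ_j↓(K)` (all `j`);
* `sSup_superlevel_isotropicCompression_le` — threshold form: the averaged problem's
  `sup {T > 0 | 1 ≤ ρ_iso(T)}` is at most the anisotropic one's.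

HYPOTHESIS MADE EXPLICIT (the physics residual, deliberately not hidden): the standard isotropic
Eliashberg equation coincides with this compression exactly when the symmetrising weights
`(πT/(ω_n Z))^{1/2}` and the Coulomb pseudopotential are channel-independent; with a channel-dependent
mass renormalisation `Z_k` the usual isotropic equation (which averages `λ_k` inside `Z`) differs
from the compression by a Jensen-type term, second order in the anisotropy. The theorems below are
about the compression; that identification is the stated assumption a screening pipeline carries.
Deliberately NOT here: the kernels as functionals of `α²F_k k'`, strong-coupling corrections,
the size of the enhancement (upper edge of the box), impurity scattering.

## References
* [HornJohnson2013] R. A. Horn, C. R. Johnson, *Matrix Analysis*, 2nd ed., CUP 2013 — Cor. 4.3.37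
  (Poincaré separation), eq. (4.3.38).
* D. Markowitz, L. P. Kadanoff, *Effect of impurities upon critical temperature of anisotropic
  superconductors*, Phys. Rev. 131 (1963) 563–575 (physics reading; not formalised).
-/

noncomputable section

open scoped Matrix

namespace Literature.MathematicalPhysics.QuantumManyBody

open Finset _root_.Matrix Literature.Analysis.Matrix

variable {M N : Type*} [Fintype M] [Fintype N] [DecidableEq M] [DecidableEq N]

/-! ### The Fermi-surface averaging frame -/

/-- The averaging frame: for each Matsubara index `n`, the vector on `M × N` equal to `√w_k` in
channel `k` at frequency `n` and `0` at other frequencies. [cite: HornJohnson2013, Cor. 4.3.37] -/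
def fsAverageFrame (w : M → ℝ) (n : N) : M × N → ℝ :=
  fun p => if p.2 = n then Real.sqrt (w p.1) else 0

omit [DecidableEq M] in
/-- The averaging frame is orthonormal when the weights are nonnegative and sum to one:
`u_a ⬝ u_b = δ_{ab}`. [cite: HornJohnson2013, Cor. 4.3.37] -/
theorem fsAverageFrame_orthonormal {w : M → ℝ} (hw : ∀ k, 0 ≤ w k) (hsum : ∑ k, w k = 1)
    (a b : N) : fsAverageFrame w a ⬝ᵥ fsAverageFrame w b = if a = b then (1 : ℝ) else 0 := by
  unfold fsAverageFrame dotProduct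
  rw [Fintype.sum_prod_type]
  by_cases hab : a = b
  · subst hab
    rw [if_pos rfl]
    have : ∀ k : M, (∑ m : N, (if (k, m).2 = a then Real.sqrt (w (k, m).1) else 0) *
        (if (k, m).2 = a then Real.sqrt (w (k, m).1) else 0)) = w k := by
      intro k
      simp only
      rw [Finset.sum_eq_single a]
      · rw [if_pos rfl, Real.mul_self_sqrt (hw k)]
      · intro m _ hm; rw [if_neg hm, zero_mul]
      · intro h; exact absurd (Finset.mem_univ a) h
    rw [Finset.sum_congr rfl fun k _ => this k, hsum]
  · rw [if_neg hab]
    apply Finset.sum_eq_zero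
    intro k _
    apply Finset.sum_eq_zero
    intro m _
    simp only
    by_cases hma : m = a
    · subst hma; rw [if_neg hab, mul_zero]
    · rw [if_neg hma, zero_mul]

/-! ### The isotropic (averaged) kernel as a compression -/

/-- **The isotropic kernel as a compression**: `B = [u_nᵀ K u_n']` with `u` the averaging frame.
[cite: HornJohnson2013, Cor. 4.3.37] -/
def isotropicCompression (K : Matrix (M × N) (M × N) ℝ) (w : M → ℝ) : Matrix N N ℝ :=
  Matrix.of fun a b => fsAverageFrame w a ⬝ᵥ K *ᵥ fsAverageFrame w b

omit [DecidableEq M] in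
/-- The compression IS the double Fermi-surface average:
`B_{ab} = Σ_k Σ_k' √w_k √w_k' K_{(k,a),(k',b)}`. [cite: HornJohnson2013, Cor. 4.3.37] -/
theorem isotropicCompression_apply (K : Matrix (M × N) (M × N) ℝ) (w : M → ℝ) (a b : N) :
    isotropicCompression K w a b =
      ∑ k, ∑ k', Real.sqrt (w k) * Real.sqrt (w k') * K (k, a) (k', b) := by
  unfold isotropicCompression fsAverageFrame
  rw [Matrix.of_apply, dotProduct, Fintype.sum_prod_type]
  refine Finset.sum_congr rfl fun k _ => ?_
  rw [Finset.sum_eq_single a]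
  · simp only [ite_true, mulVec, dotProduct]
    rw [Fintype.sum_prod_type, Finset.mul_sum]
    refine Finset.sum_congr rfl fun k' _ => ?_
    rw [Finset.sum_eq_single b]
    · simp only [ite_true]; ring
    · intro m _ hm; simp only [if_neg hm, mul_zero]
    · intro h; exact absurd (Finset.mem_univ b) h
  · intro m _ hm; simp only [if_neg hm, zero_mul]
  · intro h; exact absurd (Finset.mem_univ a) h

omit [DecidableEq M] in
/-- The compression of a symmetric kernel is symmetric. [cite: HornJohnson2013, Cor. 4.3.37] -/
theorem isHermitian_isotropicCompression {K : Matrix (M × N) (M × N) ℝ} (hK : K.IsHermitian)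
    (w : M → ℝ) : (isotropicCompression K w).IsHermitian := by
  have hKt : Kᵀ = K := by
    have := hK; unfold Matrix.IsHermitian at this
    rwa [conjTranspose_eq_transpose_of_trivial] at this
  unfold Matrix.IsHermitian isotropicCompression
  rw [conjTranspose_eq_transpose_of_trivial]
  ext a b
  rw [transpose_apply, Matrix.of_apply, Matrix.of_apply, dotProduct_mulVec, ← mulVec_transpose,
    hKt, dotProduct_comm]

/-! ### Poincaré separation: averaging cannot raise an eigenvalue, nor `T_c` -/

/-- **Averaging cannot raise an eigenvalue.** For a real symmetric anisotropic kernel `K` on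
`M × N` and weights `w ≥ 0` with `Σ w = 1`: `λ_j↓(B) ≤ λ_j↓(K)` for every `j`, `B` the isotropic
compression; with `j` the top index, the isotropic linearised-Eliashberg eigenvalue is at most the
anisotropic one at the same temperature. [cite: HornJohnson2013, Cor. 4.3.37, eq. (4.3.38)] -/
theorem eigenvalues₀_isotropicCompression_le {K : Matrix (M × N) (M × N) ℝ} (hK : K.IsHermitian)
    {w : M → ℝ} (hw : ∀ k, 0 ≤ w k) (hsum : ∑ k, w k = 1) (j : Fin (Fintype.card N)) :
    (isHermitian_isotropicCompression hK w).eigenvalues₀ j ≤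
      hK.eigenvalues₀ (Fin.castLE
        (KyFan.card_le_of_orthonormal (fsAverageFrame w) (fsAverageFrame_orthonormal hw hsum)) j) :=
  KyFan.eigenvalues₀_compression_le hK (fsAverageFrame w) (fsAverageFrame_orthonormal hw hsum)
    (isHermitian_isotropicCompression hK w) j

/-- Order lemma: a pointwise-smaller function has the smaller super-level-`1` supremum over `T > 0`.
[folklore] -/
private theorem sSup_superlevel_mono {f g : ℝ → ℝ} (h : ∀ T, f T ≤ g T)
    (hbdd : BddAbove {T : ℝ | 0 < T ∧ 1 ≤ g T}) :
    sSup {T : ℝ | 0 < T ∧ 1 ≤ f T} ≤ sSup {T : ℝ | 0 < T ∧ 1 ≤ g T} := by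
  have hsub : {T : ℝ | 0 < T ∧ 1 ≤ f T} ⊆ {T : ℝ | 0 < T ∧ 1 ≤ g T} :=
    fun T ⟨hT, h1⟩ => ⟨hT, h1.trans (h T)⟩
  by_cases hne : ({T : ℝ | 0 < T ∧ 1 ≤ f T} : Set ℝ).Nonempty
  · exact csSup_le_csSup hbdd hne hsub
  · rw [Set.not_nonempty_iff_eq_empty] at hne
    rw [hne, Real.sSup_empty]
    exact Real.sSup_nonneg fun T hT => hT.1.le

/-- **Averaging cannot raise `T_c` (threshold form).** Let `K T` be the anisotropic symmetrised
kernel at temperature `T` (symmetric, on `M × N` with `N` nonempty) and `ρ(T)`, `ρ_iso(T)` the top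
eigenvalues of `K T` and of its isotropic compression. Then
`sup {T > 0 | 1 ≤ ρ_iso(T)} ≤ sup {T > 0 | 1 ≤ ρ(T)}` whenever the right-hand set is bounded above:
the isotropic linearised-Eliashberg `T_c` is a LOWER bound for the anisotropic one — the lower edge
`1.00` of an anisotropy correction factor applied to an isotropic `T_c`.
[cite: HornJohnson2013, Cor. 4.3.37, eq. (4.3.38)] -/
theorem sSup_superlevel_isotropicCompression_le {K : ℝ → Matrix (M × N) (M × N) ℝ}
    (hK : ∀ T, (K T).IsHermitian) {w : M → ℝ} (hw : ∀ k, 0 ≤ w k) (hsum : ∑ k, w k = 1)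
    (hN : 1 ≤ Fintype.card N)
    (hbdd : BddAbove {T : ℝ | 0 < T ∧ 1 ≤ (hK T).eigenvalues₀ (Fin.castLE
      ((KyFan.card_le_of_orthonormal (fsAverageFrame w) (fsAverageFrame_orthonormal hw hsum)).trans'
        hN) 0)}) :
    sSup {T : ℝ | 0 < T ∧ 1 ≤ (isHermitian_isotropicCompression (hK T) w).eigenvalues₀
        (Fin.castLE hN 0)} ≤
      sSup {T : ℝ | 0 < T ∧ 1 ≤ (hK T).eigenvalues₀ (Fin.castLE
        ((KyFan.card_le_of_orthonormal (fsAverageFrame w) (fsAverageFrame_orthonormal hw hsum)).trans'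
          hN) 0)} := by
  refine sSup_superlevel_mono (fun T => ?_) hbdd
  have h := eigenvalues₀_isotropicCompression_le (hK T) hw hsum (Fin.castLE hN 0)
  -- `Fin.castLE _ (Fin.castLE hN 0)` and `Fin.castLE _ 0` are the same index `0`
  convert h using 2
  exact Fin.ext (by simp)

end Literature.MathematicalPhysics.QuantumManyBody

end
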